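import Summits.BirchSwinnertonDyer.BirchSwinnertonDyer.Theorems.PrintCf2RubinValueTwoFourTermCFTTLimPrelim
import Summits.BirchSwinnertonDyer.BirchSwinnertonDyer.Theorems.PrintCf2RubinValueTwoFourTermCFTImage
import Summits.BirchSwinnertonDyer.BirchSwinnertonDyer.Theorems.PrintCf2RubinValueTwoFourTermCFTAnnihilator
import Summits.BirchSwinnertonDyer.BirchSwinnertonDyer.Theorems.PrintCf2RubinValueTwoFourTermCFTLayerSelmerDictionary
import HarnessLib

/-!
# The four-term sequence of class field theory, XXVI: FINITE-LEVEL SOLVABILITY for the limit step `range u ⊇ Ann(S_A)` —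
# at a layer `E`, finitely many Selmer characters with admissible extensions take any prescribed values compatible with the
# everywhere-unramified classes on the Artin lift of ONE principal semi-local unit

Cell `bsd-print-cf2` (HOME `run/shared/lean/pub/bsd-print-cf2/`), seat `bsd-line-cf2c-w6` g5, brick §4(d)
«four-term sequence `0 → Ē_∞ → U_v → 𝒳^{(v)} → A_∞ → 0` (CFT over `𝔎_∞L′`)» of LEAD memo
`Cruxes/SplitBadTwoRankOneOfFacts/RULING-B23-g13.md` §4, crux of record stmt-BirchSwinnertonDyer-24033
`PrintCf2RubinValueTwo.TwoVariableMainConjAtSplitTwoQuad`. Step (β) of the (T-lim) plan of memo `BRICK-D-FOURTERM-PAIRING-w6g5.md` §3: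

* `exists_pow_smul_eq_zero_of_isOpen_ker` — an open-kernel character of `G_E` into a `p`-primary `M` has values killed by ONE `p^k`;
* **`exists_hom_apply_eq_artinLift`** — «`y ↦ F(Artin lift of the idèle of a reading of y)`» IS a homomorphism
  `(Semilocal.order K v E)ˣ →* A` (value independent of reading and lift: XX, XII);
* **`localUnits_mem_normGroup_of_forall_artinLift`** — if `r_L ∘ absGalEquiv` kills the Artin lifts of all principal semi-local
  units, then every principal local unit `⟨u⟩_w`, `w ∣ v`, lies in `𝒩_L` (single-component units via `Semilocal.unitsEquiv`);
* **`apply_eq_one_of_mem_inertia_of_forall_artinLift`** — an open-kernel character of `G_E` into `Multiplicative M` killing the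
  Artin lifts of all principal semi-local units kills `G_E ∩ I_𝔓(Γ_K)` for every `𝔓 ∣ v` (g3 VIII `exists_layer_of_isOpen_ker`,
  g3 IV `isUnramifiedIn_of_forall_principal_localUnits_mem_normGroup`, file IX dictionary) — «units surject onto inertia»;
* **`exists_principalUnit_forall_apply_artinLift_eq`** — FINITE-LEVEL SOLVABILITY: for Selmer classes `s_i` (`i ∈ ι` finite) over
  `𝔎_∞ = K̄^H` with admissible extensions `F_i` to `G_E`, an injective `ε : M → ℚ/ℤ` of RANK ONE on finite layers
  (`λ|_{M[p^k]} = c • ε`), a character `x` of the classes killing every `ℤ`-combination of the `s_i` unramified at `v`, and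
  `b_i ∈ M` with `ε(b_i) = x(s_i)`: there is ONE principal `y ∈ U(E)` with `F_i(u) = b_i` for every `i` and every Artin lift
  `u` of every reading of `y` (XXIV duality; the dual hypothesis holds because a killing family `λ_i = c_i • ε` gives the
  admissible character `∏ F_i^{c_i}` killing all unit lifts, hence unramified at `v`, so `Σ c_i s_i ∈ S_A` and `x` kills it).

No `sorry`, no definition, no named fact; Theses-free. No summit statement is proved; BSD is not advanced here.

## References
* [deShalit1987] E. de Shalit, *Iwasawa theory of elliptic curves with complex multiplication*, III.1.1–1.3.
* [Washington1997] L. Washington, *Introduction to Cyclotomic Fields*, GTM 83, Thm. 13.4.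
* [NeukirchANT1999] J. Neukirch, *Algebraic Number Theory*, Ch. VI (1.8), (6.6).
-/

noncomputable section

set_option linter.dupNamespace false -- D-0017: single-problem summit, `…BirchSwinnertonDyer.BirchSwinnertonDyer…` repeats a namespace by design
set_option autoImplicit false

open scoped Classical
open Field NumberField IsDedekindDomain
open Literature.NumberTheory Literature.NumberTheory.NumberFields Literature.NumberTheory.GaloisRepresentations
  Literature.NumberTheory.GaloisRepresentations.IdeleClassBar Literature.NumberTheory.EllipticCurves

namespace Summit.BirchSwinnertonDyer.BirchSwinnertonDyer.Theorems.PrintCf2.FourTermCFT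

variable {K : Type} [Field K] [NumberField K] (v : HeightOneSpectrum (𝓞 K)) (E : GalLayer K) [NumberField E.1]

/-! ### Uniform `p`-power exponents; the Artin-lift homomorphism of a semi-local unit -/

omit [NumberField E.1] in
/-- An open-kernel character of `G_E` (compact) into `Multiplicative M` with `M` `p`-primary has finitely many values, so ONE power
`p^k` kills all of them. [folklore] -/
theorem exists_pow_smul_eq_zero_of_isOpen_ker {p : ℕ} {M : Type*} [AddCommGroup M] (hM : ∀ a : M, ∃ k : ℕ, p ^ k • a = 0)
    (F : (E.openNormalSubgroup : Subgroup (absoluteGaloisGroup K)) →* Multiplicative M)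
    (hF : IsOpen (F.ker : Set (E.openNormalSubgroup : Subgroup (absoluteGaloisGroup K)))) :
    ∃ k : ℕ, ∀ g, p ^ k • Multiplicative.toAdd (F g) = 0 := by
  haveI : Finite F.range := by
    haveI := Subgroup.quotient_finite_of_isOpen' (E.openNormalSubgroup : Subgroup (absoluteGaloisGroup K)) F.ker
      E.openNormalSubgroup.isOpen hF
    exact Finite.of_equiv _ (QuotientGroup.quotientKerEquivRange F).toEquiv
  have hfin : (Set.range fun g => Multiplicative.toAdd (F g)).Finite := by
    have h1 : (F.range : Set (Multiplicative M)).Finite := Set.toFinite _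
    have h2 : (Set.range fun g => Multiplicative.toAdd (F g)) = Multiplicative.toAdd '' (F.range : Set (Multiplicative M)) := by
      ext a
      simp only [Set.mem_range, Set.mem_image, SetLike.mem_coe, MonoidHom.mem_range]
      constructor
      · rintro ⟨g, rfl⟩; exact ⟨F g, ⟨g, rfl⟩, rfl⟩
      · rintro ⟨_, ⟨g, rfl⟩, rfl⟩; exact ⟨g, rfl⟩
    rw [h2]
    exact h1.image _
  choose k hk using hM
  refine ⟨hfin.toFinset.sup k, fun g => ?_⟩
  have hmem : Multiplicative.toAdd (F g) ∈ hfin.toFinset := hfin.mem_toFinset.2 ⟨g, rfl⟩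
  have hle : k (Multiplicative.toAdd (F g)) ≤ hfin.toFinset.sup k := Finset.le_sup hmem
  obtain ⟨d, hd⟩ := Nat.exists_eq_add_of_le hle
  rw [hd, pow_add, mul_comm, mul_smul, hk, smul_zero]

/-- **The Artin-lift character of semi-local units.** For a character `F` of `G_E` with open kernel (values in any commutative
group), «`y ↦ F(u)` for `u` an Artin lift of the idèle `ι_S(y_w)` of a reading of `y`» is a well-defined HOMOMORPHISM on the units
of the order of `K_v ⊗ E` (readings exist and multiply, XX; the value depends only on the Artin symbol, XII).
[cite: deShalit1987, III.1.1–1.3] [cite: CasselsFrohlichANT1967, Ch. VII §5.1] -/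
theorem exists_hom_apply_eq_artinLift {A : Type*} [CommGroup A]
    (F : (E.openNormalSubgroup : Subgroup (absoluteGaloisGroup K)) →* A)
    (hF : IsOpen (F.ker : Set (E.openNormalSubgroup : Subgroup (absoluteGaloisGroup K)))) :
    ∃ Φ : (Semilocal.order K v E.1)ˣ →* A, ∀ (y : (Semilocal.order K v E.1)ˣ)
      (S : Finset (HeightOneSpectrum (𝓞 E.1))), (∀ w : HeightOneSpectrum (𝓞 E.1), w ∈ S ↔ w.under (𝓞 K) = v) →
      ∀ (yv : (w : HeightOneSpectrum (𝓞 E.1)) → (w.adicCompletion E.1)ˣ),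
        (∀ w : v.Extension (𝓞 E.1), (yv w.1 : w.1.adicCompletion E.1) =
          Semilocal.piEquiv K v E.1 ((y : Semilocal.order K v E.1) : Semilocal.Alg K v E.1) w) →
      ∀ (u : (E.openNormalSubgroup : Subgroup (absoluteGaloisGroup K))),
        absGaloisAbProj E.1 (E.absGalEquiv u) = ideleArtinMap E.1 (∏ w ∈ S, localUnits w (yv w)) → Φ y = F u := by
  haveI := E.finiteDimensional
  -- chosen data for each `y`
  have hdata := fun y : (Semilocal.order K v E.1)ˣ => exists_artinLift v E y
  choose u S yv hS hyv hu using hdata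
  -- independence of the data
  have hindep : ∀ (y : (Semilocal.order K v E.1)ˣ) (S' : Finset (HeightOneSpectrum (𝓞 E.1)))
      (hS' : ∀ w : HeightOneSpectrum (𝓞 E.1), w ∈ S' ↔ w.under (𝓞 K) = v)
      (yv' : (w : HeightOneSpectrum (𝓞 E.1)) → (w.adicCompletion E.1)ˣ)
      (hyv' : ∀ w : v.Extension (𝓞 E.1), (yv' w.1 : w.1.adicCompletion E.1) =
        Semilocal.piEquiv K v E.1 ((y : Semilocal.order K v E.1) : Semilocal.Alg K v E.1) w)
      (u' : (E.openNormalSubgroup : Subgroup (absoluteGaloisGroup K)))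
      (hu' : absGaloisAbProj E.1 (E.absGalEquiv u') = ideleArtinMap E.1 (∏ w ∈ S', localUnits w (yv' w))),
      F u' = F (u y) := by
    intro y S' hS' yv' hyv' u' hu'
    have hSS : S' = S y := finset_eq_of_reading v E.1 (hS y) hS'
    refine apply_eq_of_absGaloisAbProj_absGalEquiv_eq E F hF ?_
    rw [hu', hu, hSS, prod_localUnits_congr_reading v E.1 (S y) (hS y) hyv' (hyv y)]
  refine ⟨MonoidHom.mk' (fun y => F (u y)) (fun y y' => ?_), fun y S' hS' yv' hyv' u' hu' => (hindep y S' hS' yv' hyv' u' hu').symm⟩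
  -- multiplicativity: `u y · u y'` is a datum for `y y'`
  have hSS : S y' = S y := finset_eq_of_reading v E.1 (hS y) (hS y')
  have hprod : absGaloisAbProj E.1 (E.absGalEquiv (u y * u y')) =
      ideleArtinMap E.1 (∏ w ∈ S y, localUnits w ((yv y * yv y') w)) := by
    have h2 := hu y'
    rw [hSS] at h2
    rw [map_mul, map_mul, hu y, h2, ← map_mul, prod_localUnits_mul]
  rw [← map_mul]
  exact (hindep (y * y') (S y) (hS y) (yv y * yv y') (reading_mul v E.1 (hyv y) (hyv y')) _ hprod).symm

/-! ### Units surject onto the inertia above `v`: a character killing all unit lifts is unramified at `v` -/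

set_option maxHeartbeats 800000 in -- large dependent coercion types (`w.1.adicCompletion E.1`); many small steps
/-- **Single-component principal units.** If `r_L ∘ absGalEquiv` kills the Artin lifts of (the idèles of readings of) ALL principal
semi-local units of `E` at `v`, then for every place `w ∣ v` of `E` and every principal local unit `u_w ∈ U¹_w`, the local idèle
`⟨u_w⟩_w` lies in `𝒩_L` — apply the hypothesis to the principal semi-local unit with `w`-component `u_w` and all other components `1`
(`Semilocal.unitsEquiv`), whose idèle is `⟨u_w⟩_w`, and read `r_L = 1` as `ψ_{L/E} = 1` (file X, `abRestrict_ideleArtinMap_eq_one_iff`).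
[cite: deShalit1987, III.1.3] [cite: CasselsFrohlichANT1967, Ch. VII §5.1] -/
theorem localUnits_mem_normGroup_of_forall_artinLift
    (L : IntermediateField E.1 (AlgebraicClosure E.1)) [FiniteDimensional E.1 L] [IsAbelianGalois E.1 L] [NumberField L]
    (hkill : ∀ y : (Semilocal.order K v E.1)ˣ, y ∈ Semilocal.principalUnits K v E.1 →
      ∀ (S : Finset (HeightOneSpectrum (𝓞 E.1))), (∀ w : HeightOneSpectrum (𝓞 E.1), w ∈ S ↔ w.under (𝓞 K) = v) →
      ∀ (yv : (w : HeightOneSpectrum (𝓞 E.1)) → (w.adicCompletion E.1)ˣ),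
        (∀ w : v.Extension (𝓞 E.1), (yv w.1 : w.1.adicCompletion E.1) =
          Semilocal.piEquiv K v E.1 ((y : Semilocal.order K v E.1) : Semilocal.Alg K v E.1) w) →
      ∀ u : (E.openNormalSubgroup : Subgroup (absoluteGaloisGroup K)),
        absGaloisAbProj E.1 (E.absGalEquiv u) = ideleArtinMap E.1 (∏ w ∈ S, localUnits w (yv w)) →
        absRestrictNormalHom L (E.absGalEquiv u) = 1)
    (w : v.Extension (𝓞 E.1)) (uw : (w.1.adicCompletion E.1)ˣ)
    (huw : Valued.v ((uw : w.1.adicCompletion E.1) - 1) < 1) :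
    localUnits w.1 uw ∈ Automorphic.normGroup E.1 L := by
  haveI := E.finiteDimensional
  -- `u_w` as a unit of `𝒪_w`
  have hv1 : Valued.v (uw : w.1.adicCompletion E.1) = 1 := by
    have := Valuation.map_one_add_of_lt Valued.v huw
    rwa [add_sub_cancel] at this
  obtain ⟨u₀, hu₀⟩ := exists_units_map_subtype_eq_of_valued_eq_one hv1
  -- the semi-local unit with `w`-component `u_w`, other components `1` (opaque data with their equations)
  obtain ⟨c, hc1, hc2⟩ : ∃ c : (w' : v.Extension (𝓞 E.1)) → (w'.1.adicCompletionIntegers E.1)ˣ,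
      c w = u₀ ∧ ∀ w' : v.Extension (𝓞 E.1), w' ≠ w → c w' = 1 :=
    ⟨Function.update 1 w u₀, Function.update_self _ _ _, fun w' hw' => by
      rw [Function.update_of_ne hw', Pi.one_apply]⟩
  obtain ⟨y, hyc⟩ : ∃ y : (Semilocal.order K v E.1)ˣ, ∀ w' : v.Extension (𝓞 E.1),
      Semilocal.piEquiv K v E.1 ((y : Semilocal.order K v E.1) : Semilocal.Alg K v E.1) w' =
        (((c w' : (w'.1.adicCompletionIntegers E.1)ˣ) : w'.1.adicCompletionIntegers E.1) : w'.1.adicCompletion E.1) :=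
    ⟨(Semilocal.unitsEquiv K v E.1).symm c, fun w' => by
      rw [← Semilocal.coe_coe_unitsEquiv_apply]
      simp only [MulEquiv.apply_symm_apply]⟩
  have hcw : (((c w : (w.1.adicCompletionIntegers E.1)ˣ) : w.1.adicCompletionIntegers E.1) : w.1.adicCompletion E.1) =
      (uw : w.1.adicCompletion E.1) := by
    rw [hc1, ← hu₀]
    rfl
  have hcw' : ∀ w' : v.Extension (𝓞 E.1), w' ≠ w →
      (((c w' : (w'.1.adicCompletionIntegers E.1)ˣ) : w'.1.adicCompletionIntegers E.1) : w'.1.adicCompletion E.1) = 1 :=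
    fun w' hw' => by simp only [hc2 w' hw', Units.val_one, OneMemClass.coe_one]
  have hy : y ∈ Semilocal.principalUnits K v E.1 := by
    refine (Semilocal.mem_principalUnits_iff_forall_valued_lt_one K v E.1 y).2 fun w' => ?_
    by_cases hw' : w' = w
    · subst hw'
      have e : Semilocal.piEquiv K v E.1 ((y : Semilocal.order K v E.1) : Semilocal.Alg K v E.1) w' =
          (uw : w'.1.adicCompletion E.1) := (hyc w').trans hcw
      simp only [e]
      exact huw
    · have e : Semilocal.piEquiv K v E.1 ((y : Semilocal.order K v E.1) : Semilocal.Alg K v E.1) w' = 1 :=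
        (hyc w').trans (hcw' w' hw')
      simp only [e, sub_self, Valuation.map_zero]
      exact zero_lt_one
  -- its reading: `yv w'' = c ⟨w'', _⟩` over `v`, `1` elsewhere
  have hfin : Set.Finite {w'' : HeightOneSpectrum (𝓞 E.1) | w''.under (𝓞 K) = v} := by
    have : Finite (v.Extension (𝓞 E.1)) := Semilocal.finite_extension K v E.1
    exact Set.finite_coe_iff.mp this
  obtain ⟨yv, hyvc⟩ : ∃ yv : (w'' : HeightOneSpectrum (𝓞 E.1)) → (w''.adicCompletion E.1)ˣ,
      ∀ w' : v.Extension (𝓞 E.1), (yv w'.1 : w'.1.adicCompletion E.1) =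
        (((c w' : (w'.1.adicCompletionIntegers E.1)ˣ) : w'.1.adicCompletionIntegers E.1) : w'.1.adicCompletion E.1) :=
    ⟨fun w'' => if h : w''.under (𝓞 K) = v then
        Units.map (w''.adicCompletionIntegers E.1).subtype.toMonoidHom (c ⟨w'', h⟩) else 1,
      by
        rintro ⟨w', hw'⟩
        simp only [dif_pos hw']
        rfl⟩
  have hyv : ∀ w' : v.Extension (𝓞 E.1), (yv w'.1 : w'.1.adicCompletion E.1) =
      Semilocal.piEquiv K v E.1 ((y : Semilocal.order K v E.1) : Semilocal.Alg K v E.1) w' := fun w' => by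
    rw [hyc w', hyvc w']
  have hyvw : yv w.1 = uw := Units.ext ((hyvc w).trans hcw)
  have hyv1 : ∀ w' : v.Extension (𝓞 E.1), w' ≠ w → yv w'.1 = 1 := fun w' hne =>
    Units.ext (((hyvc w').trans (hcw' w' hne)).trans Units.val_one.symm)
  -- an Artin lift and the hypothesis
  have hart := exists_absGaloisAbProj_absGalEquiv_eq E
    (ideleArtinMap E.1 (∏ w'' ∈ hfin.toFinset, localUnits w'' (yv w'')))
  rcases hart with ⟨u, hu⟩
  have h0 := hkill y hy hfin.toFinset (fun w'' => hfin.mem_toFinset) yv hyv u hu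
  have h2 : abRestrict L (ideleArtinMap E.1 (∏ w'' ∈ hfin.toFinset, localUnits w'' (yv w''))) = 1 := by
    rw [← absRestrictNormalHom_absGalEquiv_eq_abRestrict E L hu]
    exact h0
  have h1 := (abRestrict_ideleArtinMap_eq_one_iff L _).1 h2
  -- the idèle is `⟨u_w⟩_w`
  have hwS : w.1 ∈ hfin.toFinset := hfin.mem_toFinset.2 w.2
  have hside : ∀ w'' ∈ hfin.toFinset, w'' ≠ w.1 → localUnits w'' (yv w'') = 1 := by
    intro w'' hw'' hne
    have hw''v : w''.under (𝓞 K) = v := hfin.mem_toFinset.1 hw''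
    have h3 : yv w'' = 1 := hyv1 ⟨w'', hw''v⟩ (fun h => hne (congrArg Subtype.val h))
    rw [h3]
    exact map_one _
  have hprod : ∏ w'' ∈ hfin.toFinset, localUnits w'' (yv w'') = localUnits w.1 uw :=
    (Finset.prod_eq_single_of_mem (f := fun w'' => localUnits w'' (yv w'')) w.1 hwS hside).trans (by rw [hyvw])
  rw [hprod] at h1
  exact h1

/-- **An open-kernel character of `G_E` into a `p`-primary group killing the Artin lifts of all principal semi-local units at `v`
kills the inertia groups above `v`** (`v ∣ p`): it factors through a finite abelian `p`-power layer `L/E` (g3 VIII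
`exists_layer_of_isOpen_ker`; `Gal(L/E) ↪ Multiplicative M` is a `p`-group), every principal `⟨u_w⟩_w` is a norm from `L`
(`localUnits_mem_normGroup_of_forall_artinLift`), so `L/E` is unramified at every `w ∣ v` (g3 IV
`isUnramifiedIn_of_forall_principal_localUnits_mem_normGroup`), i.e. `r_L` kills `I_𝔔(Γ_E)` for `𝔔 ∣ w ∣ v`, i.e. (file IX dictionary)
the character kills `G_E ∩ I_𝔓(Γ_K)` for `𝔓 ∣ v`. «The principal units map ONTO the inertia subgroup of `X`.»
[cite: deShalit1987, III.1.3] [cite: Washington1997, Thm. 13.4] -/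
theorem apply_eq_one_of_mem_inertia_of_forall_artinLift {p : ℕ} [Fact p.Prime] (hv : ((p : ℕ) : 𝓞 K) ∈ v.asIdeal)
    {M : Type*} [AddCommGroup M] (hM : ∀ a : M, ∃ k : ℕ, p ^ k • a = 0)
    (Λ : (E.openNormalSubgroup : Subgroup (absoluteGaloisGroup K)) →* Multiplicative M)
    (hΛ : IsOpen (Λ.ker : Set (E.openNormalSubgroup : Subgroup (absoluteGaloisGroup K))))
    (hkill : ∀ y : (Semilocal.order K v E.1)ˣ, y ∈ Semilocal.principalUnits K v E.1 →
      ∀ (S : Finset (HeightOneSpectrum (𝓞 E.1))), (∀ w : HeightOneSpectrum (𝓞 E.1), w ∈ S ↔ w.under (𝓞 K) = v) →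
      ∀ (yv : (w : HeightOneSpectrum (𝓞 E.1)) → (w.adicCompletion E.1)ˣ),
        (∀ w : v.Extension (𝓞 E.1), (yv w.1 : w.1.adicCompletion E.1) =
          Semilocal.piEquiv K v E.1 ((y : Semilocal.order K v E.1) : Semilocal.Alg K v E.1) w) →
      ∀ u : (E.openNormalSubgroup : Subgroup (absoluteGaloisGroup K)),
        absGaloisAbProj E.1 (E.absGalEquiv u) = ideleArtinMap E.1 (∏ w ∈ S, localUnits w (yv w)) → Λ u = 1)
    {𝔓 : Ideal (absIntegers (𝓞 K) K)} (h𝔓 : 𝔓 ∈ v.primesAbove)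
    (g : (E.openNormalSubgroup : Subgroup (absoluteGaloisGroup K)))
    (hg : (g : absoluteGaloisGroup K) ∈ 𝔓.inertia (absoluteGaloisGroup K)) : Λ g = 1 := by
  haveI := E.finiteDimensional
  -- `Λ ∘ absGalEquiv⁻¹` factors through a finite abelian layer `L/E`
  let χ : absoluteGaloisGroup E.1 →* Multiplicative M := Λ.comp E.absGalEquiv.symm.toMonoidHom
  have hχapply : ∀ u : (E.openNormalSubgroup : Subgroup (absoluteGaloisGroup K)), χ (E.absGalEquiv u) = Λ u := fun u => by
    simp only [χ, MonoidHom.comp_apply, MulEquiv.coe_toMonoidHom, MulEquiv.symm_apply_apply]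
  have hχ : IsOpen (χ.ker : Set (absoluteGaloisGroup E.1)) := by
    have : (χ.ker : Set (absoluteGaloisGroup E.1)) = E.absGalEquiv.symm ⁻¹' (Λ.ker : Set _) := by
      ext γ
      simp only [SetLike.mem_coe, MonoidHom.mem_ker, Set.mem_preimage, χ, MonoidHom.comp_apply, MulEquiv.coe_toMonoidHom]
    rw [this]
    exact hΛ.preimage (continuous_absGalEquiv_symm E)
  obtain ⟨L, hLfd, hLab, hker, χ', hχ'inj, hχ'⟩ := exists_layer_of_isOpen_ker χ hχ
  haveI := hLfd
  haveI := hLab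
  haveI : NumberField L := NumberField.of_module_finite E.1 L
  haveI : Finite (L ≃ₐ[E.1] L) := AlgEquiv.fintype E.1 L |>.finite
  -- `[L:E]` is a power of `p`
  have hPM : IsPGroup p (Multiplicative M) := fun a => by
    obtain ⟨k, hk⟩ := hM (Multiplicative.toAdd a)
    exact ⟨k, by rw [← ofAdd_toAdd a, ← ofAdd_nsmul, hk, ofAdd_zero]⟩
  have hdeg : ∃ n, Module.finrank E.1 L = p ^ n := by
    obtain ⟨n, hn⟩ := IsPGroup.iff_card.1 (hPM.of_injective χ' hχ'inj)
    exact ⟨n, by rw [← IsGalois.card_aut_eq_finrank, hn]⟩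
  -- `r_L` kills the unit lifts, hence `L/E` is unramified at every `w ∣ v`
  have hrL : ∀ y : (Semilocal.order K v E.1)ˣ, y ∈ Semilocal.principalUnits K v E.1 →
      ∀ (S : Finset (HeightOneSpectrum (𝓞 E.1))), (∀ w : HeightOneSpectrum (𝓞 E.1), w ∈ S ↔ w.under (𝓞 K) = v) →
      ∀ (yv : (w : HeightOneSpectrum (𝓞 E.1)) → (w.adicCompletion E.1)ˣ),
        (∀ w : v.Extension (𝓞 E.1), (yv w.1 : w.1.adicCompletion E.1) =
          Semilocal.piEquiv K v E.1 ((y : Semilocal.order K v E.1) : Semilocal.Alg K v E.1) w) →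
      ∀ u : (E.openNormalSubgroup : Subgroup (absoluteGaloisGroup K)),
        absGaloisAbProj E.1 (E.absGalEquiv u) = ideleArtinMap E.1 (∏ w ∈ S, localUnits w (yv w)) →
        absRestrictNormalHom L (E.absGalEquiv u) = 1 := fun y hy S hS yv hyv u hu =>
    (hker _).2 (by rw [hχapply]; exact hkill y hy S hS yv hyv u hu)
  have hunr : ∀ w : HeightOneSpectrum (𝓞 E.1), w.under (𝓞 K) = v → Algebra.IsUnramifiedIn (𝓞 L) w.asIdeal :=
    fun w hw => isUnramifiedIn_of_forall_principal_localUnits_mem_normGroup L hdeg w (natCast_mem_of_under_eq v E.1 hv hw)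
      (fun uw huw => localUnits_mem_normGroup_of_forall_artinLift v E L hrL ⟨w, hw⟩ uw huw)
  -- transport the inertia statement to `Γ_K`
  have hd := (forall_inertia_le_iff_forall_absGalEquiv_mem (E := E) {v' : HeightOneSpectrum (𝓞 K) | v' ≠ v}
    (absRestrictNormalHom L).ker).1 (fun w hw 𝔔 h𝔔 γ hγ => by
      rw [Set.mem_setOf_eq, not_not] at hw
      exact (MonoidHom.mem_ker).2
        ((isUnramifiedIn_iff_forall_inertia_absRestrictNormalHom_eq_one L w).1 (hunr w hw) 𝔔 h𝔔 γ hγ))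
  have h1 := hd v (fun h => h rfl) 𝔓 h𝔓 g hg
  rw [MonoidHom.mem_ker] at h1
  rw [← hχapply]
  exact (hker _).1 h1

/-! ### Finite-level solvability -/

set_option maxHeartbeats 800000 in -- large dependent hypothesis types; many small steps
/-- **Finite-level solvability** (step (β) of the limit step `range u ⊇ Ann(S_A)`). Let `M` be `p`-primary with an injective
character `ε : M → ℚ/ℤ` of RANK ONE on the finite layers (`λ|_{M[p^k]} = c • ε` for every character `λ`), `F_i` (`i ∈ ι` finite)
characters of `G_E` into `Multiplicative M` with open kernels (admissible extensions of Selmer cocycles), and `b_i ∈ M` such that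
every `ℤ`-combination `∑ c_i F_i` killing `G_E ∩ I_𝔓(Γ_K)` for all `𝔓 ∣ v` has `∑ c_i ε(b_i) = 0` (the character `x` of the classes
kills `S_A`). Then ONE principal semi-local unit `y ∈ U¹(E)` has `F_i(u) = b_i` for every `i` and every Artin lift `u` of every
reading of `y`. Proof: finite-family duality (XXIV `exists_of_forall_character`) for the Artin-lift homomorphisms `Φ_i`
(`exists_hom_apply_eq_artinLift`) on `U¹(E)`; a killing family `λ_i` is `c_i • ε` on a common `M[p^k]`
(`exists_pow_smul_eq_zero_of_isOpen_ker`), so `Λ = ∑ c_i F_i` kills all principal unit lifts (`ε` injective), hence the inertia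
above `v` (`apply_eq_one_of_mem_inertia_of_forall_artinLift`), and the hypothesis gives `∑ λ_i(b_i) = ∑ c_i ε(b_i) = 0`.
[cite: deShalit1987, III.1.3, III.1.7] [cite: NeukirchANT1999, Ch. VI (1.8)] -/
theorem exists_principalUnit_forall_apply_artinLift_eq {p : ℕ} [Fact p.Prime] (hv : ((p : ℕ) : 𝓞 K) ∈ v.asIdeal)
    {M : Type*} [AddCommGroup M] (hM : ∀ a : M, ∃ k : ℕ, p ^ k • a = 0)
    (ε : M →+ AddCircle (1 : ℚ)) (hε : Function.Injective ε)
    (hrank : ∀ (lam : M →+ AddCircle (1 : ℚ)) (k : ℕ), ∃ c : ℤ, ∀ a : M, p ^ k • a = 0 → lam a = c • ε a)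
    {ι : Type*} [Fintype ι] (F : ι → ((E.openNormalSubgroup : Subgroup (absoluteGaloisGroup K)) →* Multiplicative M))
    (hFo : ∀ i, IsOpen ((F i).ker : Set (E.openNormalSubgroup : Subgroup (absoluteGaloisGroup K))))
    (b : ι → M)
    (hx : ∀ c : ι → ℤ,
      (∀ 𝔓 ∈ v.primesAbove, ∀ g : (E.openNormalSubgroup : Subgroup (absoluteGaloisGroup K)),
        (g : absoluteGaloisGroup K) ∈ 𝔓.inertia (absoluteGaloisGroup K) → ∑ i, c i • Multiplicative.toAdd (F i g) = 0) →
      ∑ i, c i • ε (b i) = 0) :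
    ∃ y : (Semilocal.order K v E.1)ˣ, y ∈ Semilocal.principalUnits K v E.1 ∧
      ∀ (S : Finset (HeightOneSpectrum (𝓞 E.1))), (∀ w : HeightOneSpectrum (𝓞 E.1), w ∈ S ↔ w.under (𝓞 K) = v) →
      ∀ (yv : (w : HeightOneSpectrum (𝓞 E.1)) → (w.adicCompletion E.1)ˣ),
        (∀ w : v.Extension (𝓞 E.1), (yv w.1 : w.1.adicCompletion E.1) =
          Semilocal.piEquiv K v E.1 ((y : Semilocal.order K v E.1) : Semilocal.Alg K v E.1) w) →
      ∀ u : (E.openNormalSubgroup : Subgroup (absoluteGaloisGroup K)),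
        absGaloisAbProj E.1 (E.absGalEquiv u) = ideleArtinMap E.1 (∏ w ∈ S, localUnits w (yv w)) →
        ∀ i, F i u = Multiplicative.ofAdd (b i) := by
  -- the Artin-lift homomorphisms
  have hΦex := fun i => exists_hom_apply_eq_artinLift v E (F i) (hFo i)
  choose Φ hΦ using hΦex
  -- reduce to duality on `U¹(E)`
  suffices h : ∃ y : Semilocal.principalUnits K v E.1,
      ∀ i, ((Φ i).comp (Semilocal.principalUnits K v E.1).subtype) y = Multiplicative.ofAdd (b i) by
    obtain ⟨y, hy⟩ := h
    refine ⟨y, y.2, fun S hS yv hyv u hu i => ?_⟩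
    rw [← hΦ i y S hS yv hyv u hu]
    exact hy i
  refine exists_of_forall_character _ b fun lam hlam => ?_
  -- a common exponent `p^k` killing all values of the `F_i` and all `b_i`
  have hmono : ∀ (m : M) (a k : ℕ), a ≤ k → p ^ a • m = 0 → p ^ k • m = 0 := fun m a k hak hm => by
    obtain ⟨d, rfl⟩ := Nat.exists_eq_add_of_le hak
    rw [pow_add, mul_comm, mul_smul, hm, smul_zero]
  have hkFex := fun i => exists_pow_smul_eq_zero_of_isOpen_ker E hM (F i) (hFo i)
  choose kF hkF using hkFex
  have hkbex := fun i => hM (b i)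
  choose kb hkb using hkbex
  obtain ⟨k, hkF', hkb'⟩ : ∃ k : ℕ, (∀ i g, p ^ k • Multiplicative.toAdd (F i g) = 0) ∧ ∀ i, p ^ k • b i = 0 :=
    ⟨Finset.univ.sup kF + Finset.univ.sup kb,
      fun i g => hmono _ _ _ ((Finset.le_sup (Finset.mem_univ i)).trans (Nat.le_add_right _ _)) (hkF i g),
      fun i => hmono _ _ _ ((Finset.le_sup (Finset.mem_univ i)).trans (Nat.le_add_left _ _)) (hkb i)⟩
  -- `λ_i = c_i • ε` on `M[p^k]`
  have hcex := fun i => hrank (lam i) k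
  choose c hc using hcex
  -- the combination `Λ = ∑ c_i F_i`
  let Λ : (E.openNormalSubgroup : Subgroup (absoluteGaloisGroup K)) →* Multiplicative M :=
    MonoidHom.mk' (fun g => Multiplicative.ofAdd (∑ i, c i • Multiplicative.toAdd (F i g))) fun g g' => by
      rw [← ofAdd_add, ← Finset.sum_add_distrib]
      congr 1
      refine Finset.sum_congr rfl fun i _ => ?_
      rw [map_mul, toAdd_mul, smul_add]
  have hΛapply : ∀ g, Multiplicative.toAdd (Λ g) = ∑ i, c i • Multiplicative.toAdd (F i g) := fun g => rfl
  have hΛo : IsOpen (Λ.ker : Set (E.openNormalSubgroup : Subgroup (absoluteGaloisGroup K))) := by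
    refine Subgroup.isOpen_mono (H₁ := ⨅ i, (F i).ker) (fun g hg => ?_) ?_
    · rw [MonoidHom.mem_ker]
      apply Multiplicative.toAdd.injective
      rw [hΛapply, toAdd_one]
      refine Finset.sum_eq_zero fun i _ => ?_
      have hgi : g ∈ (F i).ker := (Subgroup.mem_iInf.1 hg) i
      rw [MonoidHom.mem_ker] at hgi
      rw [hgi, toAdd_one, smul_zero]
    · rw [Subgroup.coe_iInf]
      exact isOpen_iInter_of_finite fun i => hFo i
  -- `Λ` kills the Artin lifts of all principal units (`ε` is injective)
  have hΛkill : ∀ y : (Semilocal.order K v E.1)ˣ, y ∈ Semilocal.principalUnits K v E.1 →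
      ∀ (S : Finset (HeightOneSpectrum (𝓞 E.1))), (∀ w : HeightOneSpectrum (𝓞 E.1), w ∈ S ↔ w.under (𝓞 K) = v) →
      ∀ (yv : (w : HeightOneSpectrum (𝓞 E.1)) → (w.adicCompletion E.1)ˣ),
        (∀ w : v.Extension (𝓞 E.1), (yv w.1 : w.1.adicCompletion E.1) =
          Semilocal.piEquiv K v E.1 ((y : Semilocal.order K v E.1) : Semilocal.Alg K v E.1) w) →
      ∀ u : (E.openNormalSubgroup : Subgroup (absoluteGaloisGroup K)),
        absGaloisAbProj E.1 (E.absGalEquiv u) = ideleArtinMap E.1 (∏ w ∈ S, localUnits w (yv w)) → Λ u = 1 := by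
    intro y hy S hS yv hyv u hu
    apply Multiplicative.toAdd.injective
    rw [hΛapply, toAdd_one]
    apply hε
    rw [map_sum, map_zero]
    have h0 := hlam ⟨y, hy⟩
    refine Eq.trans (Finset.sum_congr rfl fun i _ => ?_) h0
    rw [map_zsmul, MonoidHom.comp_apply, Subgroup.coe_subtype, hΦ i y S hS yv hyv u hu]
    exact (hc i _ (hkF' i u)).symm
  -- hence `Λ` kills the inertia above `v`, and `x` kills `∑ c_i s_i`
  have hx0 := hx c fun 𝔓 h𝔓 g hg => by
    rw [← hΛapply]
    have h1 := apply_eq_one_of_mem_inertia_of_forall_artinLift v E hv hM Λ hΛo hΛkill h𝔓 g hg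
    rw [h1, toAdd_one]
  refine Eq.trans (Finset.sum_congr rfl fun i _ => ?_) hx0
  exact hc i _ (hkb' i)

end Summit.BirchSwinnertonDyer.BirchSwinnertonDyer.Theorems.PrintCf2.FourTermCFT

end
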